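import Summits.FinalStateConjecture.FinalStateConjecture.Theses.KerrnessPropagates
import Summits.FinalStateConjecture.FinalStateConjecture.Theorems.ClusterCompletenessOmegaLimitMultiKerrMotionRebase

/-!
# Route `KerrnessPropagates`, crux `KerrBasinCapture` (stmt-FinalStateConjecture-17646), line `registered`
# (skeleton `Cruxes/KerrBasinCapture/Lines/birth.lean`, lead rev 3) — stub `stub_kerrFamilyContinuity`

Continuity of the re-anchored Kerr–Schild family on stationary shells (stub T2c).

The line re-anchors hand-over slabs of the `n`-th multi-Kerr configuration to the LIMIT
configuration by a per-hole affine Poincaré re-gauging; pulling the boosted Kerr–Schild field back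
gives the "MotionRebase form" `Gₙ x = (precomp Tₙ) ∘ (g_{Mₙ,aₙ}(Tₙ (x − cₗ))) ∘ Tₙ` with frame maps
`Tₙ → Λₗ⁻¹` (operator norm) and `Tₙ (Λₗ e₀) ∈ ℝ e₀`, while the target
`boostedKerrBilin Λₗ cₗ Mₗ aₗ` is the same form with `T = Λₗ⁻¹`
(`ClusterCompleteness.boostedKerrBilin_eq_precomp_kerrBilin`, `rfl`). The stub asks for `Cᵏ`
closeness, eventually in `n` and uniformly on the shell `{ρ₁ ≤ r_{aₗ}(Λₗ⁻¹(x − cₗ)) ≤ ρ₂}`, which is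
UNBOUNDED in the time direction.

Proof. (1) Both fields are invariant under the lab translation `x ↦ x + s • Λₗ e₀`: the frame map
sends `Λₗ e₀` into `ℝ e₀` and the Kerr–Schild components are stationary
(`Kerr.bilin_add_smul_basisVector_zero`); hence so are all their derivatives
(`iteratedFDeriv_comp_add_right`). (2) Every shell point is such a translate of a point of the
COMPACT slice `K = Λₗ {y | ρ₁ ≤ r_{aₗ}(y) ≤ ρ₂, y⁰ = 0} + cₗ` (closed and bounded by
`‖y⃗‖² − a² ≤ r²`, `Kerr.spatialNorm_sq_sub_sq_le_radius_sq`). (3) On `K` the limit configuration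
has radius `≥ ρ₁ > 0`, so by the tube lemma a closed ball of configurations around it keeps the
radius positive on `K`, and there the family is `Cᵏ`-Lipschitz in the configuration
(`ClusterCompleteness.exists_norm_iteratedFDeriv_precomp_kerrBilin_sub_le`); the configurations
`((Mₙ, aₙ), (Tₙ, cₗ))` converge, so `C ‖pₙ − pₗ‖ ≤ δ` eventually.
-/

open scoped BigOperators Topology Manifold Classical Matrix InnerProductSpace ContinuousMap
open Filter Set Function TopologicalSpace
open Literature.Geometry.Lorentzian

-- D-0017: single-problem summit, `Summit.<S>.<S>.…` by design.
set_option linter.dupNamespace false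

namespace Summit.FinalStateConjecture.FinalStateConjecture.Theorems.KerrnessPropagates.KerrBasinCapture

/-! ### Stationarity of the MotionRebase form along the boosted Killing orbit -/

/-- If the frame map `T` sends the lab direction `w` into the rest-frame time axis `ℝ e₀`, the
MotionRebase form `z ↦ (precomp T) ∘ (g_{M,a}(T(z − c))) ∘ T` is invariant under `z ↦ z + s • w`
(linearity of `T` and stationarity of the Kerr–Schild components,
`Kerr.bilin_add_smul_basisVector_zero`; Kerr–Schild 1965, §2). [folklore] -/
private theorem precomp_kerrBilin_add_smul {M a : ℝ} {T : E4 →L[ℝ] E4} {c w : E4} {κ : ℝ}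
    (hw : T w = κ • E4.basisVector 0) (s : ℝ) (z : E4) :
    (ContinuousLinearMap.precomp ℝ T).comp ((Kerr.bilin M a (T (z + s • w - c))).comp T) =
      (ContinuousLinearMap.precomp ℝ T).comp ((Kerr.bilin M a (T (z - c))).comp T) := by
  have h : T (z + s • w - c) = T (z - c) + (s * κ) • E4.basisVector 0 := by
    rw [add_sub_right_comm, map_add, map_smul, hw, smul_smul]
  rw [h, Kerr.bilin_add_smul_basisVector_zero]

/-- A translation-invariant function has translation-invariant derivatives of every order
(`iteratedFDeriv_comp_add_right`). [folklore] -/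
private theorem iteratedFDeriv_eq_of_forall_add_eq {F : Type*} [NormedAddCommGroup F]
    [NormedSpace ℝ F] {f : E4 → F} {v : E4} (h : ∀ z, f (z + v) = f z) (i : ℕ) (x : E4) :
    iteratedFDeriv ℝ i f (x + v) = iteratedFDeriv ℝ i f x := by
  have hf : (fun z ↦ f (z + v)) = f := funext h
  rw [← iteratedFDeriv_comp_add_right i v x, hf]

/-- **Stationarity of all derivatives of the MotionRebase form**: under `T w ∈ ℝ e₀`,
`Dⁱ G (x + s • w) = Dⁱ G x` for `G z = (precomp T) ∘ (g_{M,a}(T(z − c))) ∘ T`. [folklore] -/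
private theorem iteratedFDeriv_precomp_kerrBilin_add_smul {M a : ℝ} {T : E4 →L[ℝ] E4} {c w : E4}
    {κ : ℝ} (hw : T w = κ • E4.basisVector 0) (i : ℕ) (x : E4) (s : ℝ) :
    iteratedFDeriv ℝ i (fun z ↦ (ContinuousLinearMap.precomp ℝ T).comp
        ((Kerr.bilin M a (T (z - c))).comp T)) (x + s • w) =
      iteratedFDeriv ℝ i (fun z ↦ (ContinuousLinearMap.precomp ℝ T).comp
        ((Kerr.bilin M a (T (z - c))).comp T)) x :=
  iteratedFDeriv_eq_of_forall_add_eq (f := fun z ↦ (ContinuousLinearMap.precomp ℝ T).comp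
    ((Kerr.bilin M a (T (z - c))).comp T)) (fun z ↦ precomp_kerrBilin_add_smul hw s z) i x

/-! ### The compact fundamental slice of a stationary shell -/

/-- The rest-frame slice `{y | ρ₁ ≤ r_a(y) ≤ ρ₂, y⁰ = 0}` of a Kerr–Schild shell is compact: it is
closed (continuity of the Kerr–Schild radius, `Kerr.continuous_radius`) and bounded, since
`‖y‖² = (y⁰)² + ‖y⃗‖²` and `‖y⃗‖² − a² ≤ r_a(y)²` (`Kerr.spatialNorm_sq_sub_sq_le_radius_sq`;
Visser arXiv:0706.0622, (35)). [folklore] -/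
private theorem isCompact_restSlice (a ρ₁ ρ₂ : ℝ) :
    IsCompact {y : E4 | ρ₁ ≤ Kerr.radius a y ∧ Kerr.radius a y ≤ ρ₂ ∧ y 0 = 0} := by
  have h0 : Continuous fun y : E4 ↦ y 0 := by fun_prop
  refine Metric.isCompact_of_isClosed_isBounded ?_ ?_
  · exact (isClosed_le continuous_const (Kerr.continuous_radius a)).inter
      ((isClosed_le (Kerr.continuous_radius a) continuous_const).inter
        (isClosed_eq h0 continuous_const))
  · refine isBounded_iff_forall_norm_le.2 ⟨√(ρ₂ ^ 2 + a ^ 2), fun y hy ↦ ?_⟩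
    obtain ⟨-, h2, hy0⟩ := hy
    have hn : ‖y‖ ^ 2 = y 0 ^ 2 + E4.spatialNorm y ^ 2 := by
      rw [EuclideanSpace.real_norm_sq_eq, Fin.sum_univ_four, E4.spatialNorm_sq]
      ring
    have hs := Kerr.spatialNorm_sq_sub_sq_le_radius_sq a y
    have hr : Kerr.radius a y ^ 2 ≤ ρ₂ ^ 2 := pow_le_pow_left₀ (Kerr.radius_nonneg a y) h2 2
    refine Real.le_sqrt_of_sq_le ?_
    rw [hn, hy0]
    nlinarith

/-- Every lab point `x` is a translate along the boosted Killing orbit `ℝ Λe₀` of a lab point whose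
rest-frame coordinates lie in the slice `{y⁰ = 0}` and have the same rest-frame spatial data:
`Λ⁻¹(x − c) = y + s e₀` with `y⁰ = 0`, `x = (Λ y + c) + s Λe₀` (Poincaré maps are affine;
O'Neill 1983, Ch. 9, p. 236). [folklore] -/
private theorem exists_restSlice_add_smul (Λ : lorentzGroup) (c x : E4) :
    ∃ y : E4, ∃ s : ℝ, y 0 = 0 ∧ poincareInv Λ c x = y + s • E4.basisVector 0 ∧
      x = ((Λ : E4 ≃L[ℝ] E4) y + c) + s • (Λ : E4 ≃L[ℝ] E4) (E4.basisVector 0) := by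
  refine ⟨poincareInv Λ c x + (-(poincareInv Λ c x 0)) • E4.basisVector 0, poincareInv Λ c x 0,
    ?_, ?_, ?_⟩
  · simp [E4.basisVector]
  · rw [add_assoc, ← add_smul, neg_add_cancel, zero_smul, add_zero]
  · rw [map_add, map_smul, neg_smul, poincareInv, ContinuousLinearEquiv.apply_symm_apply]
    abel

/-! ### Eventual `Cᵏ` closeness on a compact set -/

/-- **Eventual `Cᵏ` closeness of the MotionRebase family on a compact set.** If the limit
configuration `ϖ = ((M, a), (L, c))` has positive rest-frame radius on the compact `K ⊆ E4` and
`πₙ → ϖ`, then for every `δ > 0` eventually `‖Dⁱ g_{πₙ}(x) − Dⁱ g_ϖ(x)‖ ≤ δ` for all `i ≤ k`,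
`x ∈ K`: positivity of the radius is open in `(p, x)`
(`ClusterCompleteness.isOpen_setOf_radius_param_pos`), so by the tube lemma a closed ball of
configurations around `ϖ` times `K` stays in `{r > 0}`; there the family is `Cᵏ`-Lipschitz in the
configuration (`ClusterCompleteness.exists_norm_iteratedFDeriv_precomp_kerrBilin_sub_le`), and
`C ‖πₙ − ϖ‖ ≤ δ` eventually. [folklore] -/
private theorem eventually_norm_iteratedFDeriv_precomp_kerrBilin_sub_le {K : Set E4}
    (hK : IsCompact K) {ϖ : (ℝ × ℝ) × ((E4 →L[ℝ] E4) × E4)}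
    (hϖ : ∀ x ∈ K, 0 < Kerr.radius ϖ.1.2 (ϖ.2.1 (x - ϖ.2.2)))
    {π : ℕ → (ℝ × ℝ) × ((E4 →L[ℝ] E4) × E4)} (hπ : Tendsto π atTop (𝓝 ϖ)) (k : ℕ) {δ : ℝ}
    (hδ : 0 < δ) :
    ∀ᶠ n in atTop, ∀ i ≤ k, ∀ x ∈ K,
      ‖iteratedFDeriv ℝ i (fun z ↦ (ContinuousLinearMap.precomp ℝ (π n).2.1).comp
            ((Kerr.bilin (π n).1.1 (π n).1.2 ((π n).2.1 (z - (π n).2.2))).comp (π n).2.1)) x -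
          iteratedFDeriv ℝ i (fun z ↦ (ContinuousLinearMap.precomp ℝ ϖ.2.1).comp
            ((Kerr.bilin ϖ.1.1 ϖ.1.2 (ϖ.2.1 (z - ϖ.2.2))).comp ϖ.2.1)) x‖ ≤ δ := by
  -- a closed ball of configurations around `ϖ` over which the radius stays positive on `K`
  obtain ⟨u, v, hu, -, hϖu, hKv, huv⟩ := generalized_tube_lemma isCompact_singleton hK
    ClusterCompleteness.isOpen_setOf_radius_param_pos (fun q hq ↦ by
      obtain ⟨h1, h2⟩ := hq
      rw [mem_singleton_iff] at h1
      show 0 < Kerr.radius q.1.1.2 (q.1.2.1 (q.2 - q.1.2.2))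
      rw [h1]
      exact hϖ q.2 h2)
  obtain ⟨η, hη, hball⟩ := Metric.isOpen_iff.1 hu ϖ (hϖu (mem_singleton ϖ))
  have hParu : Metric.closedBall ϖ (η / 2) ⊆ u :=
    (Metric.closedBall_subset_ball (half_lt_self hη)).trans hball
  have hpos : ∀ p ∈ Metric.closedBall ϖ (η / 2), ∀ x ∈ K,
      0 < Kerr.radius p.1.2 (p.2.1 (x - p.2.2)) := fun p hp x hx ↦ by
    have h := huv (mk_mem_prod (hParu hp) (hKv hx))
    exact h
  obtain ⟨C, hC0, hC⟩ := ClusterCompleteness.exists_norm_iteratedFDeriv_precomp_kerrBilin_sub_le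
    (isCompact_closedBall ϖ (η / 2)) (convex_closedBall ϖ (η / 2)) hK hpos k
  have hϖB : ϖ ∈ Metric.closedBall ϖ (η / 2) := Metric.mem_closedBall_self (half_pos hη).le
  have hC1 : 0 < C + 1 := by linarith
  filter_upwards [hπ (Metric.closedBall_mem_nhds ϖ (half_pos hη)),
    hπ (Metric.closedBall_mem_nhds ϖ (div_pos hδ hC1))] with n hn1 hn2 i hi x hx
  have hd : ‖π n - ϖ‖ ≤ δ / (C + 1) := by
    rw [← dist_eq_norm]
    exact Metric.mem_closedBall.1 hn2
  calc _ ≤ C * ‖π n - ϖ‖ := hC i hi ϖ hϖB (π n) hn1 x hx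
    _ ≤ C * (δ / (C + 1)) := mul_le_mul_of_nonneg_left hd hC0
    _ ≤ δ := by
        rw [mul_div_assoc', div_le_iff₀ hC1]
        nlinarith

/-- stub T2c — **CONTINUITY OF THE RE-ANCHORED KERR–SCHILD FAMILY ON STATIONARY SHELLS**
(registered stub of crux stmt-FinalStateConjecture-17646, line `registered`). For labels
`(Mₙ, aₙ) → (Mₗ, aₗ)`, frame maps `Tₙ → Λₗ⁻¹` in operator norm with `Tₙ (Λₗ e₀) ∈ ℝ e₀`, and
every `δ > 0`: eventually in `n`, for all `i ≤ k` and all `x` in the stationary shell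
`{ρ₁ ≤ r_{aₗ}(Λₗ⁻¹(x − cₗ)) ≤ ρ₂}` (`ρ₁ > 0`), the `i`-th derivative of the MotionRebase form
`z ↦ (precomp Tₙ) ∘ (g_{Mₙ,aₙ}(Tₙ(z − cₗ))) ∘ Tₙ` is `δ`-close to that of
`boostedKerrBilin Λₗ cₗ Mₗ aₗ`. Both fields and all their derivatives are invariant under
`x ↦ x + s Λₗe₀` (`iteratedFDeriv_precomp_kerrBilin_add_smul`), every shell point is such a
translate of a point of the compact slice `Λₗ{ρ₁ ≤ r_{aₗ} ≤ ρ₂, y⁰ = 0} + cₗ`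
(`isCompact_restSlice`, `exists_restSlice_add_smul`), and on that slice the family is eventually
`δ`-close in `Cᵏ` (`eventually_norm_iteratedFDeriv_precomp_kerrBilin_sub_le`). [folklore] -/
theorem stub_kerrFamilyContinuity : ∀ (k : ℕ) (Mseq aseq : ℕ → ℝ) (Tseq : ℕ → E4 →L[ℝ] E4) (Mₗ aₗ : ℝ) (Λₗ : ↥lorentzGroup) (cₗ : E4) (ρ₁ ρ₂ : ℝ), 0 < ρ₁ → Tendsto Mseq atTop (𝓝 Mₗ) → Tendsto aseq atTop (𝓝 aₗ) → Tendsto Tseq atTop (𝓝 ((Λₗ : E4 ≃L[ℝ] E4).symm : E4 →L[ℝ] E4)) → (∀ n, ∃ κ : ℝ, Tseq n ((Λₗ : E4 ≃L[ℝ] E4) (E4.basisVector 0)) = κ • E4.basisVector 0) → ∀ δ : ℝ, 0 < δ → ∀ᶠ n in atTop, ∀ i ≤ k, ∀ x : E4, ρ₁ ≤ Kerr.radius aₗ (poincareInv Λₗ cₗ x) → Kerr.radius aₗ (poincareInv Λₗ cₗ x) ≤ ρ₂ → ‖iteratedFDeriv ℝ i (fun z ↦ (ContinuousLinearMap.precomp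 ℝ (Tseq n)).comp ((Kerr.bilin (Mseq n) (aseq n) (Tseq n (z - cₗ))).comp (Tseq n))) x - iteratedFDeriv ℝ i (boostedKerrBilin Λₗ cₗ Mₗ aₗ) x‖ ≤ δ := by
  intro k Mseq aseq Tseq Mₗ aₗ Λₗ cₗ ρ₁ ρ₂ hρ₁ hM ha hT hκ δ hδ
  -- the compact fundamental slice of the shell, pushed to the lab frame, and the limit
  -- configuration `ϖ = ((Mₗ, aₗ), (Λₗ⁻¹, cₗ))`
  set K : Set E4 := (fun y ↦ (Λₗ : E4 ≃L[ℝ] E4) y + cₗ) ''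
    {y : E4 | ρ₁ ≤ Kerr.radius aₗ y ∧ Kerr.radius aₗ y ≤ ρ₂ ∧ y 0 = 0} with hK
  set ϖ : (ℝ × ℝ) × ((E4 →L[ℝ] E4) × E4) :=
    ((Mₗ, aₗ), (((Λₗ : E4 ≃L[ℝ] E4).symm : E4 →L[ℝ] E4), cₗ)) with hϖ
  have hKc : IsCompact K := (isCompact_restSlice aₗ ρ₁ ρ₂).image (by fun_prop)
  have hposK : ∀ x ∈ K, 0 < Kerr.radius ϖ.1.2 (ϖ.2.1 (x - ϖ.2.2)) := by
    rintro _ ⟨y, hy, rfl⟩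
    show 0 < Kerr.radius aₗ ((Λₗ : E4 ≃L[ℝ] E4).symm ((Λₗ : E4 ≃L[ℝ] E4) y + cₗ - cₗ))
    rw [add_sub_cancel_right, ContinuousLinearEquiv.symm_apply_apply]
    exact hρ₁.trans_le hy.1
  have hπ : Tendsto (fun n ↦ (((Mseq n, aseq n), (Tseq n, cₗ)) : (ℝ × ℝ) × ((E4 →L[ℝ] E4) × E4)))
      atTop (𝓝 ϖ) :=
    (hM.prodMk_nhds ha).prodMk_nhds (hT.prodMk_nhds tendsto_const_nhds)
  filter_upwards [eventually_norm_iteratedFDeriv_precomp_kerrBilin_sub_le hKc hposK hπ k hδ]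
    with n hn i hi x hx1 hx2
  -- translate `x` along the Killing orbit into the slice
  obtain ⟨κ, hκn⟩ := hκ n
  obtain ⟨y, s, hy0, hyx, rfl⟩ := exists_restSlice_add_smul Λₗ cₗ x
  rw [hyx, Kerr.radius_add_time_smul_basisVector] at hx1 hx2
  have hyK : (Λₗ : E4 ≃L[ℝ] E4) y + cₗ ∈ K := ⟨y, ⟨hx1, hx2, hy0⟩, rfl⟩
  have hLw : ((Λₗ : E4 ≃L[ℝ] E4).symm : E4 →L[ℝ] E4) ((Λₗ : E4 ≃L[ℝ] E4) (E4.basisVector 0)) =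
      (1 : ℝ) • E4.basisVector 0 := by
    rw [one_smul, ContinuousLinearEquiv.coe_coe, ContinuousLinearEquiv.symm_apply_apply]
  -- `boostedKerrBilin Λₗ cₗ Mₗ aₗ` is the member `ϖ` of the family (definitional unfolding)
  rw [show boostedKerrBilin Λₗ cₗ Mₗ aₗ = fun z ↦
      (ContinuousLinearMap.precomp ℝ ((Λₗ : E4 ≃L[ℝ] E4).symm : E4 →L[ℝ] E4)).comp
        ((Kerr.bilin Mₗ aₗ (((Λₗ : E4 ≃L[ℝ] E4).symm : E4 →L[ℝ] E4) (z - cₗ))).comp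
          ((Λₗ : E4 ≃L[ℝ] E4).symm : E4 →L[ℝ] E4)) from rfl,
    iteratedFDeriv_precomp_kerrBilin_add_smul hκn, iteratedFDeriv_precomp_kerrBilin_add_smul hLw]
  exact hn i hi _ hyK

end Summit.FinalStateConjecture.FinalStateConjecture.Theorems.KerrnessPropagates.KerrBasinCapture
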